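import Summits.QuantumFields.YangMills.Theorems.BalabanUVNodesPortS1JacKStepDefs

/-!
# NODE O port PT-A — THE `k`-STEP READING WITH THE RECORD REMOVED: `JacKStepCore F` — [B7] Props. 1–2 ∕ [I] p.263 L8–10 for COMPLEX small fields, stated ON THE TOWER REGION OF ONE COARSE BOND,
# free of `recordUc`, of the gauge orbit, of DEF-1's coordinates and of the cube letter `Mc` (the analytic statement a porter of [B7] Props. 1–2 to `SL(2,ℂ)` proves; `JacKStep F` follows:
# companion `…JacKStepCore.jacKStep_of_core`)

Cell `ym-nodeO-ideate`, porter seat `ymgap-nodeO-port-PTA-1` (gen 6); DEFINITION file, `--supports stmt-QuantumFields-27930`.  [I] = [Balaban1987RG1], [B7] = [12] = [Balaban1985Averaging].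
Vocabulary OF RECORD reused verbatim: 11b's (1.11)–(1.13) letters `B12RegularSpaces111.expI ∕ plaq ∕ nabla` (`exp iξA`, the plaquette variable `∂U(p)`, the covariant derivative `∇^ξ_U`),
`Node00.plaqInside`, the tower region `B^{k+1} ⁻¹' {c₋, c₊}` and `bondsIn` (dag-n12-c), `loopMh ∕ iterMh` (the holomorphic (0.4) model), `Params.eta` (`ξ = L^{−(k+1)}`).
WHAT IT SAYS.  `TowerSmallField k c ξ α₀ α₁ 𝐕`: on the fine bonds of the tower region of `c`, `𝐕 = e^{iξA} U` with `U ∈ SU(2)`, `A ∈ 𝔰𝔩₂(ℂ)`, `‖A‖ < α₁`; on the plaquettes inside the region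
`‖∂U − 1‖ < α₀ξ²` AND `‖∂(e^{iξA}U) − 1‖ < α₀ξ²`; on the derivative squares inside the region `‖∇^ξ_U A‖ < α₁` — i.e. conditions (i)(ii)(iii) of (1.11)–(1.14) READ ON THE REGION (the local-gauge
clause (1.12) and the `𝐉`-clause dropped: not needed for loops).  `JacKStepCore F`: for every loop threshold `a > 0` there are radii `α₀ α₁ > 0` such that at every level `k + 1 ≤ m + K`, bond `c`
and field `𝐕` with `TowerSmallField k c (eta (k+1)) α₀ α₁ 𝐕`, every (0.4) loop matrix of the averages `Ū^j(𝐕)`, `j ≤ k`, at the region's level-`(j+1)` bonds is within `a` of `1` — print's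
«M˙(𝐔) = Ū^p on Λ_p, |∂Ū^p − 1| < 2α₀′(L^pξ)²» ([I] p.263 L8–10) with [B7] Prop. 2 (54) «|Ū^k(∂p) − 1| < α₀ + 2C₀α₀² < 2α₀» for COMPLEX near-unitary fields (print proves the unitary case only,
[B7] p.18 «G ⊂ U(N)»; tree: `B7Prop2Explicit.prop2_explicit`, `B12Average012Prop2.prop2_012`), plus «loops from plaquettes» (non-abelian Stokes with norm control).  UNIFORM IN `k` through the
scaled radius `ξ = L^{−(k+1)}`.
* `TowerSmallField k c ξ α₀ α₁ 𝐕 : Prop`, `JacKStepCore F : Prop`.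
NOT PROVED HERE; NOT a Literature fact as stated (it is the tree's (0.4) model on the tree's torus); its mathematical content is [B7] Props. 1–2 for `SL(2,ℂ)`-valued small fields — GENUINE, L.

HONEST FRAMING.  Definitions; NOTHING of Bałaban asserted or proved; `stub_LZjacKStep` ∕ `stub_LZjacDom` OPEN; 27930 OPEN · no claim; K0⁷∕K-Ax OPEN; NODE O 0∕1; COUNT 8∕28 · K 1∕4 UNMOVED; finite
`𝕋⁴_{L^K}` at fixed ε — NOT continuum ∕ OS ∕ Clay; **the Yang–Mills mass gap is NOT proved by any of this.**  No `sorry`, no `instance`, no `notation`; standard axioms.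
-/

noncomputable section

open scoped BigOperators Matrix.Norms.L2Operator Topology

namespace Summit.QuantumFields.YangMills.Theorems.BalabanUVNodesPortS1

open Summit.QuantumFields.YangMills.Theorems.K0RecordFormatNames
open Literature.MathematicalPhysics.QuantumFieldTheory.Balaban1983to89
open Literature.MathematicalPhysics.QuantumFieldTheory.Balaban1983to89.Node00
open Literature.MathematicalPhysics.QuantumFieldTheory.Balaban1983to89.T4Continuum (T4Family)
open Literature.MathematicalPhysics.QuantumFieldTheory.Balaban1983to89.BlockAveraging (Idx)
open Literature.MathematicalPhysics.QuantumFieldTheory.Balaban1983to89.B15AveragingHolomorphic (loopMh iterMh)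
open Literature.MathematicalPhysics.QuantumFieldTheory.Balaban1983to89.B10Eq42TorusConstraint (bondsIn)

/-- **`TowerSmallField k c ξ α₀ α₁ 𝐕` — CONDITIONS (i)(ii)(iii) OF (1.11)–(1.14) READ ON THE TOWER REGION `B^{k+1} ⁻¹' {c₋, c₊}`** of a level-`(k+1)` bond: a factorisation `𝐕 = e^{iξA}·U` on the
region's fine bonds with `U ∈ SU(2)`, `A` traceless, `‖A‖ < α₁`; `‖∂U(p) − 1‖ < α₀ξ²` and `‖∂(e^{iξA}U)(p) − 1‖ < α₀ξ²` at the plaquettes inside the region; `‖(∇^ξ_U A)‖ < α₁` at the derivative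
squares inside the region ((1.12) and the `𝐉`-clause are not read). [cite: Balaban1987RG1, (1.11)–(1.14) p.262] -/
def TowerSmallField {P : Params} (k : ℕ) (c : PBond P (k + 1)) (ξ α₀ α₁ : ℝ) (V : PBond P 0 → MatA 2) : Prop :=
  ∃ (U : PBond P 0 → (MatA 2)ˣ) (A : PBond P 0 → MatA 2),
    (∀ b : PBond P 0, b ∈ bondsIn 0 (B14.Eq22Determines.blockIter (k + 1) ⁻¹' ({c.src, c.tgt} : Set (Site P (k + 1)))) →
      V b = ((B12RegularSpaces111.expI ξ (A b) * U b : (MatA 2)ˣ) : MatA 2) ∧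
        ((U b : (MatA 2)ˣ) : MatA 2) ∈ Matrix.specialUnitaryGroup (Fin 2) ℂ ∧ (A b).trace = 0 ∧ ‖A b‖ < α₁) ∧
    (∀ p : Plaq P 0, p ∈ plaqInside (B14.Eq22Determines.blockIter (k + 1) ⁻¹' ({c.src, c.tgt} : Set (Site P (k + 1)))) →
      ‖((B12RegularSpaces111.plaq U p : (MatA 2)ˣ) : MatA 2) - 1‖ < α₀ * ξ ^ 2 ∧
        ‖((B12RegularSpaces111.plaq (fun b => B12RegularSpaces111.expI ξ (A b) * U b) p : (MatA 2)ˣ) : MatA 2) - 1‖ < α₀ * ξ ^ 2) ∧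
    (∀ q : Site P 0 × Fin P.d × Fin P.d,
      q.1 ∈ B14.Eq22Determines.blockIter (k + 1) ⁻¹' ({c.src, c.tgt} : Set (Site P (k + 1))) →
      q.1.shift q.2.1 ∈ B14.Eq22Determines.blockIter (k + 1) ⁻¹' ({c.src, c.tgt} : Set (Site P (k + 1))) →
      q.1.shift q.2.2 ∈ B14.Eq22Determines.blockIter (k + 1) ⁻¹' ({c.src, c.tgt} : Set (Site P (k + 1))) →
      (q.1.shift q.2.1).shift q.2.2 ∈ B14.Eq22Determines.blockIter (k + 1) ⁻¹' ({c.src, c.tgt} : Set (Site P (k + 1))) →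
        ‖B12RegularSpaces111.nabla ξ U q.2.1 (fun y => A ⟨y, q.2.2⟩) q.1‖ < α₁)

/-- ★★ **`JacKStepCore F` — [B7] PROPS. 1–2 FOR COMPLEX SMALL FIELDS ON THE TOWER REGION, in loop currency**: for every `a > 0` there are `α₀ α₁ > 0` such that at every level `k + 1 ≤ m + K`,
bond `c` and field `𝐕` with `TowerSmallField k c (eta (k+1)) α₀ α₁ 𝐕`, for all `j ≤ k`, all level-`(j+1)` bonds `c′` of the region and all indices `i`:
`‖loopMh (iterMh j 𝐕) c′ i − 1‖ ≤ a` («|∂Ū^p − 1| < 2α₀′(L^pξ)²», uniformly in `k`). [cite: Balaban1987RG1, p.263 L8–10, (0.4) p.253; Balaban1985Averaging, Prop. 1 (51), Prop. 2 (54) p.26] -/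
def JacKStepCore (F : T4Family) : Prop :=
  ∀ a : ℝ, 0 < a → ∃ α₀ α₁ : ℝ, 0 < α₀ ∧ 0 < α₁ ∧ ∀ (k K : ℕ), k + 1 ≤ (F.P K).m + (F.P K).K →
    ∀ (c : PBond (F.P K) (k + 1)) (V : PBond (F.P K) 0 → MatA 2), TowerSmallField k c ((F.P K).eta (k + 1)) α₀ α₁ V →
      ∀ j : ℕ, j ≤ k → ∀ c' : PBond (F.P K) (j + 1),
        c' ∈ bondsIn (j + 1) (B14.Eq22Determines.blockIter (k + 1) ⁻¹' ({c.src, c.tgt} : Set (Site (F.P K) (k + 1)))) →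
          ∀ i : Idx (F.P K), ‖loopMh (iterMh j V) c' i - 1‖ ≤ a

end Summit.QuantumFields.YangMills.Theorems.BalabanUVNodesPortS1

end
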